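import Summits.CriticalPhenomena.PercolationContinuityZ3.Theorems.PercNearOneGluingNoHeavyLowerTailCubicThreePointFibreTable
import Mathlib.Combinatorics.Colex
import Mathlib.Data.Nat.Bitwise
import HarnessLib

/-!
# `NoHeavyLowerTail` (stmt-CriticalPhenomena-4575) — fibre criterion for SHK3⁺, III: bitmasks

Support file (prover prim-sahi-p2; `--supports stmt-CriticalPhenomena-4575`), continuing `…FibreCriterion` / `…FibreTable`.
Configurations inside `D` are encoded as bitmasks by an edge numbering `idx` injective on `D` (`toMask`); unions / intersections /
differences become `|||`, `&&&`, `Nat.ldiff` (`toMask_union`, `toMask_inter`, `toMask_sdiff`), `toMask_injOn`; the determined third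
copy and the profile test become bit arithmetic (`mk3M`, `data3M`, `toMask_mk3`, `data3_eq_iff_mask`; `bdiff` = `ldiff` through the fast
primitives).  Part IV (`…FibreEnum`) assembles the `native_decide`-ready double loop `FibM`.
[cite: Gladkov2024StrongFKG, Cor. 4.2 (the cubic row SHK3⁺ ⊇ AG)]
-/

namespace Summit.CriticalPhenomena.PercolationContinuityZ3.Theorems

namespace TerminalGluing

open Finset SimpleGraph Literature.Probability.Percolation Literature.Probability.Percolation.DecisionTree
open CubicThreePointStep CubicThreePointTerminal

variable {V : Type*} [DecidableEq V]

/-! ### Bitmask evaluation: the fibre sums as a pure integer/bitmask computation -/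

section Mask

/-- The `j`-th bit of `Σ_{i ∈ T} 2^i` is set iff `j ∈ T`. [folklore] -/
theorem testBit_sum_two_pow (T : Finset ℕ) (j : ℕ) : (∑ i ∈ T, 2 ^ i).testBit j = true ↔ j ∈ T := by
  have h1 : Finset.equivBitIndices (∑ i ∈ T, 2 ^ i) = T := Finset.equivBitIndices.apply_symm_apply T
  rw [Finset.equivBitIndices_apply] at h1
  constructor
  · intro h
    rw [← h1, List.mem_toFinset, Nat.mem_bitIndices]; exact h
  · intro h
    rw [← h1, List.mem_toFinset, Nat.mem_bitIndices] at h; exact h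

variable (idx : Sym2 V → ℕ)

/-- The bitmask of a configuration under an edge numbering `idx`. [folklore] -/
def toMask (S : Finset (Sym2 V)) : ℕ := ∑ e ∈ S, 2 ^ idx e

omit [DecidableEq V] in
/-- Bits of the mask of `S` are the indices of the edges of `S` (for `idx` injective on `S`). [folklore] -/
theorem testBit_toMask {S : Finset (Sym2 V)} (hinj : Set.InjOn idx ↑S) (j : ℕ) :
    (toMask idx S).testBit j = true ↔ ∃ e ∈ S, idx e = j := by
  unfold toMask
  rw [← Finset.sum_image (f := fun i => 2 ^ i) hinj, testBit_sum_two_pow, Finset.mem_image]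

variable {D : Finset (Sym2 V)} (hinj : Set.InjOn idx ↑D)
include hinj

/-- `toMask` turns unions into bitwise or. [folklore] -/
theorem toMask_union {S T : Finset (Sym2 V)} (hS : S ⊆ D) (hT : T ⊆ D) :
    toMask idx (S ∪ T) = toMask idx S ||| toMask idx T := by
  apply Nat.eq_of_testBit_eq; intro j
  rw [Bool.eq_iff_iff, Nat.testBit_lor, Bool.or_eq_true,
    testBit_toMask idx (hinj.mono (Finset.coe_subset.mpr (Finset.union_subset hS hT))),
    testBit_toMask idx (hinj.mono (Finset.coe_subset.mpr hS)), testBit_toMask idx (hinj.mono (Finset.coe_subset.mpr hT))]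
  constructor
  · rintro ⟨e, he, rfl⟩
    rcases Finset.mem_union.mp he with he | he
    · exact Or.inl ⟨e, he, rfl⟩
    · exact Or.inr ⟨e, he, rfl⟩
  · rintro (⟨e, he, rfl⟩ | ⟨e, he, rfl⟩)
    · exact ⟨e, Finset.mem_union.mpr (Or.inl he), rfl⟩
    · exact ⟨e, Finset.mem_union.mpr (Or.inr he), rfl⟩

/-- `toMask` turns intersections into bitwise and. [folklore] -/
theorem toMask_inter {S T : Finset (Sym2 V)} (hS : S ⊆ D) (hT : T ⊆ D) :
    toMask idx (S ∩ T) = toMask idx S &&& toMask idx T := by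
  apply Nat.eq_of_testBit_eq; intro j
  rw [Bool.eq_iff_iff, Nat.testBit_land, Bool.and_eq_true,
    testBit_toMask idx (hinj.mono (Finset.coe_subset.mpr (Finset.inter_subset_left.trans hS))),
    testBit_toMask idx (hinj.mono (Finset.coe_subset.mpr hS)), testBit_toMask idx (hinj.mono (Finset.coe_subset.mpr hT))]
  constructor
  · rintro ⟨e, he, rfl⟩
    rw [Finset.mem_inter] at he
    exact ⟨⟨e, he.1, rfl⟩, ⟨e, he.2, rfl⟩⟩
  · rintro ⟨⟨e, he, rfl⟩, ⟨e', he', h'⟩⟩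
    have hee : e' = e := hinj (hT he') (hS he) h'
    subst hee
    exact ⟨e', Finset.mem_inter.mpr ⟨he, he'⟩, rfl⟩

/-- `toMask` turns set difference into `Nat.ldiff`. [folklore] -/
theorem toMask_sdiff {S T : Finset (Sym2 V)} (hS : S ⊆ D) (hT : T ⊆ D) :
    toMask idx (S \ T) = Nat.ldiff (toMask idx S) (toMask idx T) := by
  apply Nat.eq_of_testBit_eq; intro j
  rw [Bool.eq_iff_iff, Nat.testBit_ldiff, Bool.and_eq_true,
    testBit_toMask idx (hinj.mono (Finset.coe_subset.mpr (Finset.sdiff_subset.trans hS))),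
    testBit_toMask idx (hinj.mono (Finset.coe_subset.mpr hS))]
  have hT' : ((toMask idx T).testBit j = true) ↔ ∃ e ∈ T, idx e = j :=
    testBit_toMask idx (hinj.mono (Finset.coe_subset.mpr hT)) j
  constructor
  · rintro ⟨e, he, rfl⟩
    rw [Finset.mem_sdiff] at he
    refine ⟨⟨e, he.1, rfl⟩, ?_⟩
    cases hb : (toMask idx T).testBit (idx e)
    · rfl
    · exfalso
      obtain ⟨e', he', h'⟩ := hT'.mp hb
      have hee : e' = e := hinj (hT he') (hS he.1) h'
      exact he.2 (hee ▸ he')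
  · rintro ⟨⟨e, he, rfl⟩, hb⟩
    refine ⟨e, Finset.mem_sdiff.mpr ⟨he, fun heT => ?_⟩, rfl⟩
    have : (toMask idx T).testBit (idx e) = true := hT'.mpr ⟨e, heT, rfl⟩
    rw [this] at hb
    exact Bool.noConfusion hb

omit [DecidableEq V] in
/-- `toMask` is injective on the subsets of `D`. [folklore] -/
theorem toMask_injOn {S T : Finset (Sym2 V)} (hS : S ⊆ D) (hT : T ⊆ D) (h : toMask idx S = toMask idx T) : S = T := by
  have key : ∀ {S T : Finset (Sym2 V)}, S ⊆ D → T ⊆ D → toMask idx S = toMask idx T → S ⊆ T := by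
    intro S T hS hT h e he
    have hb : (toMask idx S).testBit (idx e) = true :=
      (testBit_toMask idx (hinj.mono (Finset.coe_subset.mpr hS)) _).mpr ⟨e, he, rfl⟩
    rw [h] at hb
    obtain ⟨e', he', h'⟩ := (testBit_toMask idx (hinj.mono (Finset.coe_subset.mpr hT)) _).mp hb
    have hee : e' = e := hinj (hT he') (hS he) h'
    exact hee ▸ he'
  exact Finset.Subset.antisymm (key hS hT h) (key hT hS h.symm)

omit hinj in
/-- Bit difference `a ∧ ¬b` through the primitive (fast) operations `|||`, `^^^`. [folklore] -/
def bdiff (a b : ℕ) : ℕ := (a ||| b) ^^^ b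

omit hinj in
/-- `bdiff = Nat.ldiff`. [folklore] -/
theorem bdiff_eq (a b : ℕ) : bdiff a b = Nat.ldiff a b := by
  apply Nat.eq_of_testBit_eq; intro j
  rw [bdiff, Nat.testBit_xor, Nat.testBit_lor, Nat.testBit_ldiff]
  cases a.testBit j <;> cases b.testBit j <;> rfl

omit hinj in
/-- Mask form of `mk3`. [folklore] -/
def mk3M (a₁ a₂ a₃ m₁ m₂ : ℕ) : ℕ :=
  (a₃ ||| bdiff (bdiff a₂ a₃) (m₁ &&& m₂)) ||| bdiff (bdiff a₁ a₂) (m₁ ||| m₂)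

omit hinj in
/-- Mask form of `data3`. [folklore] -/
def data3M (m₁ m₂ m₃ : ℕ) : ℕ × ℕ × ℕ :=
  ((m₁ ||| m₂) ||| m₃, ((m₁ &&& m₂) ||| (m₁ &&& m₃)) ||| (m₂ &&& m₃), (m₁ &&& m₂) &&& m₃)

/-- `toMask` of `mk3` is `mk3M` of the masks (everything inside `D`). [folklore] -/
theorem toMask_mk3 {A : Finset (Sym2 V) × Finset (Sym2 V) × Finset (Sym2 V)} (hA : A.1 ⊆ D) (hn : A.2.2 ⊆ A.2.1 ∧ A.2.1 ⊆ A.1)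
    {S₁ S₂ : Finset (Sym2 V)} (hS₁ : S₁ ⊆ D) (hS₂ : S₂ ⊆ D) :
    toMask idx (mk3 A S₁ S₂) = mk3M (toMask idx A.1) (toMask idx A.2.1) (toMask idx A.2.2) (toMask idx S₁) (toMask idx S₂) := by
  have h21 : A.2.1 ⊆ D := hn.2.trans hA
  have h22 : A.2.2 ⊆ D := hn.1.trans h21
  unfold mk3 mk3M
  simp only [bdiff_eq]
  rw [toMask_union idx hinj (Finset.union_subset h22 (Finset.sdiff_subset.trans (Finset.sdiff_subset.trans h21)))
      (Finset.sdiff_subset.trans (Finset.sdiff_subset.trans hA)),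
    toMask_union idx hinj h22 (Finset.sdiff_subset.trans (Finset.sdiff_subset.trans h21)),
    toMask_sdiff idx hinj (Finset.sdiff_subset.trans h21) (Finset.inter_subset_left.trans hS₁),
    toMask_sdiff idx hinj h21 h22, toMask_inter idx hinj hS₁ hS₂,
    toMask_sdiff idx hinj (Finset.sdiff_subset.trans hA) (Finset.union_subset hS₁ hS₂),
    toMask_sdiff idx hinj hA h21, toMask_union idx hinj hS₁ hS₂]

/-- `data3 = A` iff the mask profile equals the mask of `A` (everything inside `D`). [folklore] -/
theorem data3_eq_iff_mask {A : Finset (Sym2 V) × Finset (Sym2 V) × Finset (Sym2 V)} (hA : A.1 ⊆ D) (hn : A.2.2 ⊆ A.2.1 ∧ A.2.1 ⊆ A.1)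
    {S₁ S₂ S₃ : Finset (Sym2 V)} (hS₁ : S₁ ⊆ D) (hS₂ : S₂ ⊆ D) (hS₃ : S₃ ⊆ D) :
    data3 S₁ S₂ S₃ = A ↔
      data3M (toMask idx S₁) (toMask idx S₂) (toMask idx S₃) = (toMask idx A.1, toMask idx A.2.1, toMask idx A.2.2) := by
  have h21 : A.2.1 ⊆ D := hn.2.trans hA
  have h22 : A.2.2 ⊆ D := hn.1.trans h21
  have e1 : toMask idx (S₁ ∪ S₂ ∪ S₃) = (toMask idx S₁ ||| toMask idx S₂) ||| toMask idx S₃ := by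
    rw [toMask_union idx hinj (Finset.union_subset hS₁ hS₂) hS₃, toMask_union idx hinj hS₁ hS₂]
  have e2 : toMask idx (S₁ ∩ S₂ ∪ S₁ ∩ S₃ ∪ S₂ ∩ S₃) =
      ((toMask idx S₁ &&& toMask idx S₂) ||| (toMask idx S₁ &&& toMask idx S₃)) ||| (toMask idx S₂ &&& toMask idx S₃) := by
    rw [toMask_union idx hinj (Finset.union_subset (Finset.inter_subset_left.trans hS₁) (Finset.inter_subset_left.trans hS₁))
        (Finset.inter_subset_left.trans hS₂),
      toMask_union idx hinj (Finset.inter_subset_left.trans hS₁) (Finset.inter_subset_left.trans hS₁),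
      toMask_inter idx hinj hS₁ hS₂, toMask_inter idx hinj hS₁ hS₃, toMask_inter idx hinj hS₂ hS₃]
  have e3 : toMask idx (S₁ ∩ S₂ ∩ S₃) = (toMask idx S₁ &&& toMask idx S₂) &&& toMask idx S₃ := by
    rw [toMask_inter idx hinj (Finset.inter_subset_left.trans hS₁) hS₃, toMask_inter idx hinj hS₁ hS₂]
  obtain ⟨A₁, A₂, A₃⟩ := A
  simp only [data3, data3M, Prod.mk.injEq]
  rw [← e1, ← e2, ← e3]
  constructor
  · rintro ⟨h1, h2, h3⟩
    rw [h1, h2, h3]; exact ⟨rfl, rfl, rfl⟩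
  · rintro ⟨h1, h2, h3⟩
    exact ⟨toMask_injOn idx hinj (Finset.union_subset (Finset.union_subset hS₁ hS₂) hS₃) hA h1,
      toMask_injOn idx hinj (Finset.union_subset (Finset.union_subset (Finset.inter_subset_left.trans hS₁)
        (Finset.inter_subset_left.trans hS₁)) (Finset.inter_subset_left.trans hS₂)) h21 h2,
      toMask_injOn idx hinj ((Finset.inter_subset_left.trans Finset.inter_subset_left).trans hS₁) h22 h3⟩

end Mask

end TerminalGluing

end Summit.CriticalPhenomena.PercolationContinuityZ3.Theorems
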